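import Summits.AtomisticToContinuum.Crystallization.Theorems.PricedLinkCensusLocalToGlobalDefs
import Literature.Geometry.DiscreteGeometry.KissingPatterns

/-!
# The fcc point set: minimal norm, and the Voronoi cell is cut out by the twelve nearest neighbours

Route `PricedLinkCensus`, crux `LocalToGlobal` (stmt-AtomisticToContinuum-14232), line
`flux-cell-joint-census`, support for the registered stub `stub_fccMirrorExact : NewtonShell8 → FccMirrorExact`
(`Theorems/PricedLinkCensusLocalToGlobalDefs`).  Elementary lattice geometry of
`fccSet a = (a/√2)·{n ∈ ℤ³ : Σ nₖ even}` (the `Defs` file's fcc point set with nearest-neighbour distance `a`;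
`intVec n` is the tree's integer vector of `Literature.Geometry.DiscreteGeometry.KissingPatterns`):

* `fccSet a` is an additive subgroup of `ℝ³`; its nonzero vectors have norm `≥ a` (`le_norm_of_mem_fccSet`),
  the twelve `(a/√2)(±eₖ ± eₗ)` have norm `a`;
* THE VORONOI CELL OF fcc IS CUT OUT BY ITS TWELVE NEAREST NEIGHBOURS (`mem_fccVoronoi_of_facets`, registered
  sub-goal `fccVoronoi_of_facets`): if `‖z‖ < ‖z - v‖` for the twelve minimal vectors `v`, then `‖z‖ < ‖z - w‖`
  for EVERY nonzero `w ∈ fcc(a)` (in coordinates `u = (√2/a) z`: `|uₖ| + |uₗ| < 1` for `k ≠ l` implies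
  `2⟪u, n⟫ < ‖n‖²` for every nonzero even-sum `n ∈ ℤ³` — a finite check for `‖n‖_∞ ≤ 2` and a crude bound
  beyond, `voronoi_core`); the open cell `fccVoronoi a` lies in `B(0, a)`, and its translates by two points
  differing by a nonzero fcc vector are disjoint (`disjoint_vadd_fccVoronoi`) — the rhombic dodecahedra tile.

References: J. H. Conway, N. J. A. Sloane, *Sphere packings, lattices and groups* (1999), Ch. 4 §6.2
(`D₃ = fcc`), Ch. 21 (Voronoi cells; the relevant vectors of a root lattice are its minimal vectors); folklore.
-/

noncomputable section

open scoped BigOperators RealInnerProductSpace Pointwise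
open MeasureTheory Metric Set Function Literature.Geometry.DiscreteGeometry

namespace Summit.AtomisticToContinuum.Crystallization.Theorems.PricedLinkCensusLocalToGlobal

/-! ### Integer vectors and the subgroup `fcc(a)` -/

/-- `intVec 0 = 0` (`intVec` is the tree's `Literature.Geometry.DiscreteGeometry.intVec`). [folklore] -/
theorem intVec_zero' : intVec (0 : Fin 3 → ℤ) = 0 := by
  ext k; simp

/-- `‖intVec n‖² = Σ nₖ²`. [folklore] -/
theorem norm_intVec_sq (n : Fin 3 → ℤ) : ‖intVec n‖ ^ 2 = ∑ k, ((n k : ℝ)) ^ 2 := by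
  rw [EuclideanSpace.norm_sq_eq]
  simp [sq_abs]

/-- `⟪z, intVec n⟫ = Σ zₖ nₖ`. [folklore] -/
theorem inner_intVec_right (z : E3) (n : Fin 3 → ℤ) : ⟪z, intVec n⟫ = ∑ k, z k * (n k : ℝ) := by
  rw [PiLp.inner_apply]
  refine Finset.sum_congr rfl fun k _ => ?_
  simp [mul_comm]

/-- Unfolding `fccSet` through `intVec`. [folklore] -/
theorem mem_fccSet_iff {a : ℝ} {p : E3} :
    p ∈ fccSet a ↔ ∃ n : Fin 3 → ℤ, Even (∑ k, n k) ∧ p = (a / Real.sqrt 2) • intVec n := Iff.rfl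

/-- `(a/√2)·n ∈ fcc(a)` for even-sum `n`. [folklore] -/
theorem smul_intVec_mem_fccSet (a : ℝ) {n : Fin 3 → ℤ} (hn : Even (∑ k, n k)) :
    (a / Real.sqrt 2) • intVec n ∈ fccSet a := ⟨n, hn, rfl⟩

/-- `0 ∈ fcc(a)`. [folklore] -/
theorem zero_mem_fccSet (a : ℝ) : (0 : E3) ∈ fccSet a :=
  mem_fccSet_iff.2 ⟨0, by simp, by rw [intVec_zero', smul_zero]⟩

/-- `fcc(a)` is closed under addition. [folklore] -/
theorem add_mem_fccSet {a : ℝ} {p q : E3} (hp : p ∈ fccSet a) (hq : q ∈ fccSet a) : p + q ∈ fccSet a := by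
  obtain ⟨n, hn, rfl⟩ := mem_fccSet_iff.1 hp
  obtain ⟨m, hm, rfl⟩ := mem_fccSet_iff.1 hq
  refine mem_fccSet_iff.2 ⟨n + m, ?_, by rw [← smul_add]; congr 1; ext k; simp⟩
  simp only [Pi.add_apply, Finset.sum_add_distrib]
  exact hn.add hm

/-- `fcc(a)` is closed under negation. [folklore] -/
theorem neg_mem_fccSet {a : ℝ} {p : E3} (hp : p ∈ fccSet a) : -p ∈ fccSet a := by
  obtain ⟨n, hn, rfl⟩ := mem_fccSet_iff.1 hp
  refine mem_fccSet_iff.2 ⟨-n, ?_, by rw [← smul_neg]; congr 1; ext k; simp⟩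
  simp only [Pi.neg_apply, Finset.sum_neg_distrib]
  exact hn.neg

/-- `fcc(a)` is closed under subtraction. [folklore] -/
theorem sub_mem_fccSet {a : ℝ} {p q : E3} (hp : p ∈ fccSet a) (hq : q ∈ fccSet a) : p - q ∈ fccSet a := by
  rw [sub_eq_add_neg]; exact add_mem_fccSet hp (neg_mem_fccSet hq)

/-- `‖(a/√2)·n‖² = (a²/2) Σ nₖ²`. [folklore] -/
theorem norm_smul_intVec_sq (a : ℝ) (n : Fin 3 → ℤ) :
    ‖(a / Real.sqrt 2) • intVec n‖ ^ 2 = a ^ 2 / 2 * ∑ k, ((n k : ℝ)) ^ 2 := by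
  rw [norm_smul, mul_pow, norm_intVec_sq, Real.norm_eq_abs, sq_abs, div_pow, Real.sq_sqrt two_pos.le]

/-- A nonzero even-sum integer vector has `Σ nₖ² ≥ 2` (`Σ nₖ² ≡ Σ nₖ (mod 2)`). [folklore] -/
theorem two_le_sum_sq {n : Fin 3 → ℤ} (hn : Even (∑ k, n k)) (h0 : n ≠ 0) : (2 : ℤ) ≤ ∑ k, n k ^ 2 := by
  have h1 : Even (∑ k, (n k ^ 2 - n k)) := Finset.even_sum _ fun k _ => by
    rw [show n k ^ 2 - n k = n k * (n k - 1) by ring]; exact Int.even_mul_pred_self (n k)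
  have h2 : ∑ k, n k ^ 2 = ∑ k, (n k ^ 2 - n k) + ∑ k, n k := by
    rw [Finset.sum_sub_distrib]; ring
  have h3 : Even (∑ k, n k ^ 2) := by rw [h2]; exact h1.add hn
  have h4 : ∃ k, n k ≠ 0 := by
    by_contra h
    push Not at h
    exact h0 (funext h)
  obtain ⟨k, hk⟩ := h4
  have h5 : (1 : ℤ) ≤ ∑ k, n k ^ 2 := by
    have hle : n k ^ 2 ≤ ∑ k, n k ^ 2 :=
      Finset.single_le_sum (f := fun k => n k ^ 2) (fun k _ => sq_nonneg (n k)) (Finset.mem_univ k)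
    have hpos : 0 < n k ^ 2 := by positivity
    linarith
  obtain ⟨r, hr⟩ := h3
  omega

/-- **Minimal norm of fcc.** Nonzero vectors of `fcc(a)` have norm at least `a`. [folklore] -/
theorem le_norm_of_mem_fccSet {a : ℝ} {p : E3} (hp : p ∈ fccSet a) (h0 : p ≠ 0) : a ≤ ‖p‖ := by
  obtain ⟨n, hn, rfl⟩ := mem_fccSet_iff.1 hp
  have hn0 : n ≠ 0 := by
    rintro rfl
    exact h0 (by rw [intVec_zero', smul_zero])
  have h2 : (2 : ℝ) ≤ ∑ k, ((n k : ℝ)) ^ 2 := by exact_mod_cast two_le_sum_sq hn hn0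
  have hsq : a ^ 2 ≤ ‖(a / Real.sqrt 2) • intVec n‖ ^ 2 := by
    rw [norm_smul_intVec_sq]; nlinarith [sq_nonneg a]
  exact le_of_pow_le_pow_left₀ two_ne_zero (norm_nonneg _) hsq

/-- Distinct points of a translate of `fcc(a)` are at distance `≥ a`. [folklore] -/
theorem le_dist_of_sub_mem_fccSet {a : ℝ} {p q : E3} (h : p - q ∈ fccSet a) (hne : p ≠ q) :
    a ≤ dist p q := by
  rw [dist_eq_norm]
  exact le_norm_of_mem_fccSet h (sub_ne_zero.2 hne)

/-- A vector `(a/√2)·m` with `Σ mₖ² = 2` has norm `a` (`a > 0`). [folklore] -/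
theorem norm_smul_intVec_of_sum_sq {a : ℝ} (ha : 0 < a) {m : Fin 3 → ℤ} (hm : (∑ k, ((m k : ℝ)) ^ 2) = 2) :
    ‖(a / Real.sqrt 2) • intVec m‖ = a := by
  have h : ‖(a / Real.sqrt 2) • intVec m‖ ^ 2 = a ^ 2 := by rw [norm_smul_intVec_sq, hm]; ring
  exact (sq_eq_sq₀ (norm_nonneg _) ha.le).1 h

/-! ### The Voronoi cell of fcc is cut out by the twelve nearest neighbours -/

/-- `‖z‖ < ‖z - v‖ ↔ 2⟪z, v⟫ < ‖v‖²`. [folklore] -/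
theorem norm_lt_norm_sub_iff (z v : E3) : ‖z‖ < ‖z - v‖ ↔ 2 * ⟪z, v⟫ < ‖v‖ ^ 2 := by
  rw [← sq_lt_sq₀ (norm_nonneg _) (norm_nonneg _), norm_sub_sq_real]
  constructor <;> intro h <;> linarith

/-- In coordinates `uₖ = zₖ/(a/√2)`: `2⟪z, (a/√2)n⟫ < ‖(a/√2)n‖² ↔ 2 Σ uₖ nₖ < Σ nₖ²`. [folklore] -/
theorem facet_iff {a : ℝ} (ha : 0 < a) (z : E3) (n : Fin 3 → ℤ) :
    2 * ⟪z, (a / Real.sqrt 2) • intVec n⟫ < ‖(a / Real.sqrt 2) • intVec n‖ ^ 2 ↔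
      2 * ∑ k, z k / (a / Real.sqrt 2) * (n k : ℝ) < ∑ k, ((n k : ℝ)) ^ 2 := by
  set c : ℝ := a / Real.sqrt 2 with hc
  have hcpos : 0 < c := by positivity
  have h1 : ⟪z, c • intVec n⟫ = c * (c * ∑ k, z k / c * (n k : ℝ)) := by
    rw [inner_smul_right, inner_intVec_right, Finset.mul_sum, Finset.mul_sum, Finset.mul_sum]
    refine Finset.sum_congr rfl fun k _ => ?_
    field_simp
  have h2 : ‖c • intVec n‖ ^ 2 = c * (c * ∑ k, ((n k : ℝ)) ^ 2) := by
    rw [hc, norm_smul_intVec_sq, ← mul_assoc, ← sq, div_pow, Real.sq_sqrt two_pos.le]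
  rw [h1, h2, show 2 * (c * (c * ∑ k, z k / c * (n k : ℝ))) = c * (c * (2 * ∑ k, z k / c * (n k : ℝ))) by ring,
    mul_lt_mul_iff_right₀ hcpos, mul_lt_mul_iff_right₀ hcpos]

/-- `|x| + |y| < 1` from the four sign combinations. [folklore] -/
theorem abs_add_abs_lt_one {x y : ℝ} (h1 : x + y < 1) (h2 : x - y < 1) (h3 : -x + y < 1) (h4 : -x - y < 1) :
    |x| + |y| < 1 := by
  rcases abs_cases x with ⟨hx, -⟩ | ⟨hx, -⟩ <;> rcases abs_cases y with ⟨hy, -⟩ | ⟨hy, -⟩ <;>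
    rw [hx, hy] <;> linarith

/-- The crude case of the Voronoi lemma: if `|N₀| ≥ 3`, `|U₀| < 1`, `|U₁| + |U₂| < 1`, then
`2(U₀N₀ + U₁N₁ + U₂N₂) < N₀² + N₁² + N₂²`. [folklore] -/
theorem voronoi_big {U0 U1 U2 : ℝ} {N0 N1 N2 : ℤ} (hN0 : 3 ≤ |N0|) (h0 : |U0| < 1) (h12 : |U1| + |U2| < 1) :
    2 * (U0 * N0 + U1 * N1 + U2 * N2) < (N0 : ℝ) ^ 2 + (N1 : ℝ) ^ 2 + (N2 : ℝ) ^ 2 := by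
  have hA : (3 : ℝ) ≤ |(N0 : ℝ)| := by rw [← Int.cast_abs]; exact_mod_cast hN0
  set M : ℝ := max |(N1 : ℝ)| |(N2 : ℝ)| with hM
  have hM0 : 0 ≤ M := le_max_of_le_left (abs_nonneg _)
  have e0 : U0 * N0 ≤ |U0| * |(N0 : ℝ)| := by rw [← abs_mul]; exact le_abs_self _
  have e0' : |U0| * |(N0 : ℝ)| < |(N0 : ℝ)| := mul_lt_of_lt_one_left (by linarith) h0
  have e1 : U1 * N1 ≤ |U1| * M :=
    calc U1 * N1 ≤ |U1| * |(N1 : ℝ)| := by rw [← abs_mul]; exact le_abs_self _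
      _ ≤ |U1| * M := mul_le_mul_of_nonneg_left (le_max_left _ _) (abs_nonneg _)
  have e2 : U2 * N2 ≤ |U2| * M :=
    calc U2 * N2 ≤ |U2| * |(N2 : ℝ)| := by rw [← abs_mul]; exact le_abs_self _
      _ ≤ |U2| * M := mul_le_mul_of_nonneg_left (le_max_right _ _) (abs_nonneg _)
  have e12 : (|U1| + |U2|) * M ≤ M := mul_le_of_le_one_left hM0 h12.le
  have r0 : 2 * |(N0 : ℝ)| + 3 ≤ (N0 : ℝ) ^ 2 := by
    have : (N0 : ℝ) ^ 2 = |(N0 : ℝ)| ^ 2 := (sq_abs _).symm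
    nlinarith
  have rM : M ^ 2 ≤ (N1 : ℝ) ^ 2 + (N2 : ℝ) ^ 2 := by
    rcases le_total |(N1 : ℝ)| |(N2 : ℝ)| with h | h
    · rw [hM, max_eq_right h, sq_abs]; nlinarith [sq_nonneg (N1 : ℝ)]
    · rw [hM, max_eq_left h, sq_abs]; nlinarith [sq_nonneg (N2 : ℝ)]
  have r12 : 2 * M - 1 ≤ (N1 : ℝ) ^ 2 + (N2 : ℝ) ^ 2 := by nlinarith [sq_nonneg (M - 1)]
  nlinarith

/-- **The Voronoi lemma for fcc, in coordinates.** If `|uₖ| + |uₗ| < 1` for the three pairs `k ≠ l`, then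
`2 Σ uₖ nₖ < Σ nₖ²` for every nonzero even-sum `n ∈ ℤ³`: the twelve facet inequalities of the rhombic
dodecahedron imply all the other bisector inequalities of the lattice. [cite: ConwaySloane1999, Ch. 21 Thm 7] -/
theorem voronoi_core {u : Fin 3 → ℝ} (h01 : |u 0| + |u 1| < 1) (h02 : |u 0| + |u 2| < 1)
    (h12 : |u 1| + |u 2| < 1) {n : Fin 3 → ℤ} (hn : Even (∑ k, n k)) (h0 : n ≠ 0) :
    2 * ∑ k, u k * (n k : ℝ) < ∑ k, ((n k : ℝ)) ^ 2 := by
  have ha0 : |u 0| < 1 := by linarith [abs_nonneg (u 1)]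
  have ha1 : |u 1| < 1 := by linarith [abs_nonneg (u 0)]
  have ha2 : |u 2| < 1 := by linarith [abs_nonneg (u 0)]
  have hne : ¬(n 0 = 0 ∧ n 1 = 0 ∧ n 2 = 0) := by
    rintro ⟨e0, e1, e2⟩
    refine h0 (funext fun k => ?_)
    fin_cases k <;> assumption
  simp only [Fin.sum_univ_three] at hn ⊢
  by_cases hb0 : |n 0| ≤ 2
  · by_cases hb1 : |n 1| ≤ 2
    · by_cases hb2 : |n 2| ≤ 2
      · -- the finite check `‖n‖_∞ ≤ 2`
        have hu0 := abs_lt.1 ha0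
        have hu1 := abs_lt.1 ha1
        have hu2 := abs_lt.1 ha2
        have hs01 : ∀ s t : ℝ, |s| = 1 → |t| = 1 → s * u 0 + t * u 1 < 1 := fun s t hs ht => by
          rcases (abs_eq zero_le_one).1 hs with rfl | rfl <;> rcases (abs_eq zero_le_one).1 ht with rfl | rfl <;>
            cases abs_cases (u 0) <;> cases abs_cases (u 1) <;> linarith
        have hs02 : ∀ s t : ℝ, |s| = 1 → |t| = 1 → s * u 0 + t * u 2 < 1 := fun s t hs ht => by
          rcases (abs_eq zero_le_one).1 hs with rfl | rfl <;> rcases (abs_eq zero_le_one).1 ht with rfl | rfl <;>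
            cases abs_cases (u 0) <;> cases abs_cases (u 2) <;> linarith
        have hs12 : ∀ s t : ℝ, |s| = 1 → |t| = 1 → s * u 1 + t * u 2 < 1 := fun s t hs ht => by
          rcases (abs_eq zero_le_one).1 hs with rfl | rfl <;> rcases (abs_eq zero_le_one).1 ht with rfl | rfl <;>
            cases abs_cases (u 1) <;> cases abs_cases (u 2) <;> linarith
        have p01 := hs01 1 1 abs_one abs_one
        have m01 := hs01 1 (-1) abs_one (by simp)
        have q01 := hs01 (-1) 1 (by simp) abs_one
        have r01 := hs01 (-1) (-1) (by simp) (by simp)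
        have p02 := hs02 1 1 abs_one abs_one
        have m02 := hs02 1 (-1) abs_one (by simp)
        have q02 := hs02 (-1) 1 (by simp) abs_one
        have r02 := hs02 (-1) (-1) (by simp) (by simp)
        have p12 := hs12 1 1 abs_one abs_one
        have m12 := hs12 1 (-1) abs_one (by simp)
        have q12 := hs12 (-1) 1 (by simp) abs_one
        have r12 := hs12 (-1) (-1) (by simp) (by simp)
        generalize hN0 : n 0 = N0 at *
        generalize hN1 : n 1 = N1 at *
        generalize hN2 : n 2 = N2 at *
        obtain ⟨l0, r0⟩ := abs_le.1 hb0
        obtain ⟨l1, r1⟩ := abs_le.1 hb1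
        obtain ⟨l2, r2⟩ := abs_le.1 hb2
        interval_cases N0 <;> interval_cases N1 <;> interval_cases N2 <;>
          first
            | exact absurd hn (by decide)
            | exact (hne ⟨rfl, rfl, rfl⟩).elim
            | (push_cast; linarith)
      · have h3 : 3 ≤ |n 2| := by omega
        have := voronoi_big (U1 := u 0) (U2 := u 1) (N1 := n 0) (N2 := n 1) h3 ha2 h01
        linarith
    · have h3 : 3 ≤ |n 1| := by omega
      have := voronoi_big (U1 := u 0) (U2 := u 2) (N1 := n 0) (N2 := n 2) h3 ha1 h02
      linarith
  · have h3 : 3 ≤ |n 0| := by omega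
    have := voronoi_big (U1 := u 1) (U2 := u 2) (N1 := n 1) (N2 := n 2) h3 ha0 h12
    linarith

/-- From the twelve facet inequalities in coordinates to `|uₖ| + |uₗ| < 1` (`u = z/c`). [folklore] -/
theorem abs_add_abs_lt_of_facets {c : ℝ} {z : E3}
    (hf : ∀ m : Fin 3 → ℤ, Even (∑ k, m k) → (∑ k, ((m k : ℝ)) ^ 2) = 2 → 2 * ∑ k, z k / c * (m k : ℝ) < 2) :
    |z 0 / c| + |z 1 / c| < 1 ∧ |z 0 / c| + |z 2 / c| < 1 ∧ |z 1 / c| + |z 2 / c| < 1 := by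
  have e1 := hf ![1, 1, 0] (by decide) (by simp [Fin.sum_univ_three]; norm_num)
  have e2 := hf ![1, -1, 0] (by decide) (by simp [Fin.sum_univ_three]; norm_num)
  have e3 := hf ![-1, 1, 0] (by decide) (by simp [Fin.sum_univ_three]; norm_num)
  have e4 := hf ![-1, -1, 0] (by decide) (by simp [Fin.sum_univ_three]; norm_num)
  have f1 := hf ![1, 0, 1] (by decide) (by simp [Fin.sum_univ_three]; norm_num)
  have f2 := hf ![1, 0, -1] (by decide) (by simp [Fin.sum_univ_three]; norm_num)
  have f3 := hf ![-1, 0, 1] (by decide) (by simp [Fin.sum_univ_three]; norm_num)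
  have f4 := hf ![-1, 0, -1] (by decide) (by simp [Fin.sum_univ_three]; norm_num)
  have g1 := hf ![0, 1, 1] (by decide) (by simp [Fin.sum_univ_three]; norm_num)
  have g2 := hf ![0, 1, -1] (by decide) (by simp [Fin.sum_univ_three]; norm_num)
  have g3 := hf ![0, -1, 1] (by decide) (by simp [Fin.sum_univ_three]; norm_num)
  have g4 := hf ![0, -1, -1] (by decide) (by simp [Fin.sum_univ_three]; norm_num)
  simp [Fin.sum_univ_three] at e1 e2 e3 e4 f1 f2 f3 f4 g1 g2 g3 g4
  exact ⟨abs_add_abs_lt_one (by linarith) (by linarith) (by linarith) (by linarith),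
    abs_add_abs_lt_one (by linarith) (by linarith) (by linarith) (by linarith),
    abs_add_abs_lt_one (by linarith) (by linarith) (by linarith) (by linarith)⟩

/-- THE OPEN VORONOI CELL OF THE ORIGIN IN `fcc(a)`: points strictly closer to `0` than to every other point of
`fcc(a)` (the open rhombic dodecahedron of inradius `a/2`). [folklore] -/
def fccVoronoi (a : ℝ) : Set E3 := {z | ∀ w ∈ fccSet a, w ≠ 0 → ‖z‖ < ‖z - w‖}

/-- **The rhombic dodecahedron is the Voronoi cell**: the twelve facet conditions `‖z‖ < ‖z - v‖`,
`v ∈ fcc(a)`, `‖v‖ = a`, already put `z` in `fccVoronoi a`. [cite: ConwaySloane1999, Ch. 21 Thm 7] -/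
theorem mem_fccVoronoi_of_facets {a : ℝ} (ha : 0 < a) {z : E3}
    (h : ∀ v ∈ fccSet a, ‖v‖ = a → ‖z‖ < ‖z - v‖) : z ∈ fccVoronoi a := by
  set c : ℝ := a / Real.sqrt 2 with hc
  -- the facet conditions in coordinates
  have hf : ∀ m : Fin 3 → ℤ, Even (∑ k, m k) → (∑ k, ((m k : ℝ)) ^ 2) = 2 →
      2 * ∑ k, z k / c * (m k : ℝ) < 2 := fun m hm hm2 => by
    have h1 := h (c • intVec m) (smul_intVec_mem_fccSet a hm) (norm_smul_intVec_of_sum_sq ha hm2)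
    rw [norm_lt_norm_sub_iff, facet_iff ha, hm2] at h1
    exact h1
  obtain ⟨h01, h02, h12⟩ := abs_add_abs_lt_of_facets hf
  -- an arbitrary nonzero lattice vector
  intro w hw hw0
  obtain ⟨n, hn, rfl⟩ := mem_fccSet_iff.1 hw
  have hn0 : n ≠ 0 := by
    rintro rfl
    exact hw0 (by rw [intVec_zero', smul_zero])
  rw [norm_lt_norm_sub_iff, facet_iff ha]
  exact voronoi_core (u := fun k => z k / c) h01 h02 h12 hn hn0

/-- Points of the open cell are within `a` of the centre (indeed within the circumradius `a/√2`). [folklore] -/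
theorem norm_lt_of_mem_fccVoronoi {a : ℝ} (ha : 0 < a) {z : E3} (hz : z ∈ fccVoronoi a) : ‖z‖ < a := by
  set c : ℝ := a / Real.sqrt 2 with hc
  have hcpos : 0 < c := by positivity
  have hf : ∀ m : Fin 3 → ℤ, Even (∑ k, m k) → (∑ k, ((m k : ℝ)) ^ 2) = 2 →
      2 * ∑ k, z k / c * (m k : ℝ) < 2 := fun m hm hm2 => by
    have hv0 : c • intVec m ≠ 0 := fun h0 => by
      have := norm_smul_intVec_of_sum_sq ha hm2
      rw [← hc, h0, norm_zero] at this
      exact ha.ne this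
    have h1 := hz (c • intVec m) (smul_intVec_mem_fccSet a hm) hv0
    rw [norm_lt_norm_sub_iff, facet_iff ha, hm2] at h1
    exact h1
  obtain ⟨h01, -, h12⟩ := abs_add_abs_lt_of_facets hf
  -- `|u₀| + |u₁| < 1`, `|u₂| < 1`, so `Σ uₖ² < 2` and `‖z‖² = c² Σ uₖ² < 2c² = a²`
  have h2 : |z 2 / c| < 1 := by linarith [abs_nonneg (z 1 / c)]
  have hsum : (z 0 / c) ^ 2 + (z 1 / c) ^ 2 + (z 2 / c) ^ 2 < 2 := by
    have k0 : (z 0 / c) ^ 2 + (z 1 / c) ^ 2 ≤ (|z 0 / c| + |z 1 / c|) ^ 2 := by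
      rw [← sq_abs (z 0 / c), ← sq_abs (z 1 / c)]; nlinarith [abs_nonneg (z 0 / c), abs_nonneg (z 1 / c)]
    have k1 : (|z 0 / c| + |z 1 / c|) ^ 2 < 1 := by
      have h0 : 0 ≤ |z 0 / c| + |z 1 / c| := by positivity
      nlinarith
    have k2 : (z 2 / c) ^ 2 < 1 := by
      rw [← sq_abs]; nlinarith [abs_nonneg (z 2 / c)]
    linarith
  have hz2 : ‖z‖ ^ 2 = c ^ 2 * ((z 0 / c) ^ 2 + (z 1 / c) ^ 2 + (z 2 / c) ^ 2) := by
    rw [EuclideanSpace.norm_sq_eq, Fin.sum_univ_three]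
    simp only [Real.norm_eq_abs, sq_abs]
    field_simp
  have hc2 : c ^ 2 * 2 = a ^ 2 := by rw [hc, div_pow, Real.sq_sqrt two_pos.le]; ring
  have hlt : ‖z‖ ^ 2 < a ^ 2 := by
    rw [hz2, ← hc2]; exact mul_lt_mul_of_pos_left hsum (pow_pos hcpos 2)
  exact lt_of_pow_lt_pow_left₀ 2 ha.le hlt

/-- **Lattice translates of the open cell are disjoint**: for `p ≠ q` with `q - p ∈ fcc(a)`,
`(p +ᵥ fccVoronoi a) ∩ (q +ᵥ fccVoronoi a) = ∅` (a common point would be strictly closer to `p` than to `q`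
and vice versa). [folklore] -/
theorem disjoint_vadd_fccVoronoi {a : ℝ} {p q : E3} (hpq : q - p ∈ fccSet a) (hne : p ≠ q) :
    Disjoint (p +ᵥ fccVoronoi a) (q +ᵥ fccVoronoi a) := by
  refine Set.disjoint_left.2 fun z hzp hzq => ?_
  rw [Set.mem_vadd_set_iff_neg_vadd_mem, vadd_eq_add, neg_add_eq_sub] at hzp hzq
  have h1 := hzp (q - p) hpq (sub_ne_zero.2 hne.symm)
  have h2 := hzq (p - q) (by simpa using neg_mem_fccSet hpq) (sub_ne_zero.2 hne)
  rw [show z - p - (q - p) = z - q by abel] at h1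
  rw [show z - q - (p - q) = z - p by abel] at h2
  exact lt_asymm h1 h2

/-- **Registered sub-goal `fccVoronoi_of_facets`** (line `flux-cell-joint-census`, support of
`stub_fccMirrorExact`): the twelve facet inequalities of the rhombic dodecahedron cut out the Voronoi cell of
`fcc(a)`, binder form of `mem_fccVoronoi_of_facets`. [cite: ConwaySloane1999, Ch. 21 Thm 7] -/
theorem fccVoronoi_of_facets : ∀ (a : ℝ), 0 < a → ∀ z : E3,
    (∀ v ∈ fccSet a, ‖v‖ = a → ‖z‖ < ‖z - v‖) → z ∈ fccVoronoi a :=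
  fun _ ha _ h => mem_fccVoronoi_of_facets ha h

end Summit.AtomisticToContinuum.Crystallization.Theorems.PricedLinkCensusLocalToGlobal

end
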